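import Mathlib
import Literature.Combinatorics.Additive.TripleProductProperty
import Literature.Barriers.MatrixMultiplication.QuasirandomBarrierSTPP
import Summits.MatrixMultiplication.MatrixMultiplication.Theorems.PairwiseCurvedTilingsLC.Negative.UniformEta

/-!
# What a certificate at exponent `w` demands of the configuration: packing `Σᵢ Vᵢ^{2/3} ≤ |G|` and the
# volume threshold `max Vᵢ > d³ · (|G| / Σᵢ Vᵢ^{2/3})^{3/(w−2)}`

Support file for route `MatrixMultiplication/GroupTheoreticSTPP`, crux `stmt-MatrixMultiplication-0597`
(`CNonabelianTPPFamilies`), cell `mm-stpp` (D-0046).  The certificate rows of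
`GroupTheoreticSTPPCNonabelianTPPFamiliesCriterion.lean` conclude `ω ≤ w` from
`d^{w−2}|G| < Σᵢ Vᵢ^{w/3}` (`Vᵢ = |Aᵢ||Bᵢ||Cᵢ|`, all degrees `≤ d`; `d = 1` for abelian hosts).  For the
census's PRE-REGISTERED thresholds one needs the converse bookkeeping: how large must the triples of an
STPP family be before such an inequality is even possible?  Two elementary facts, valid in every finite
group (AM–GM in the form `(abc)^{2/3} ≤ (ab+bc+ca)/3` is the tree's
`PairwiseCurvedTilingsLC.Negative.rpow_two_thirds_le`):

* `sum_rpow_two_thirds_le_card` — **packing at exponent `2/3`**: for an STPP family of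
  non-empty sets, `Σᵢ Vᵢ^{2/3} ≤ |G|` (AM–GM on the three pairwise packing bounds
  `Σ|Aᵢ||Bᵢ|, Σ|Bᵢ||Cᵢ|, Σ|Cᵢ||Aᵢ| ≤ |G|` of Blasiak et al. 2017 §2, tree
  `SimultaneousTPP.sum_card_mul_card_le` and `simultaneousTPP_rotate`).  So the *packing efficiency*
  `η = Σᵢ Vᵢ^{2/3} / |G|` of any family is `≤ 1`.
* `certificate_volume_threshold` — if `Vᵢ ≤ M` for all `i` and `d^{w−2}|G| < Σᵢ Vᵢ^{w/3}` with `w > 2`,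
  then `d^{w−2}|G| < M^{(w−2)/3} Σᵢ Vᵢ^{2/3}`, i.e. (`certificate_volume_threshold'`)
  `d³ · (|G| / Σᵢ Vᵢ^{2/3})^{3/(w−2)} < M`: a certificate at `w` needs a triple of volume
  `> d³ η^{−3/(w−2)}`.  Numerically `3/(w−2) = 8.08` at `w = 2.3713`, `7.5` at `2.4`, `6` at `2.5`, `3`
  at `w = 3`; e.g. at packing efficiency `η = 1/2` a family can certify `ω ≤ 2.3713` only with a
  triple of volume `> 270 d³`, and the CKSU 2005 §5 two-triple design in `ℤ₄×ℤ₅×ℤ₇` (`η ≈ 0.25`,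
  `V = 72`) would need `V > 8·10⁴` at its efficiency.

WHAT THIS IS NOT: no statement about `ω`; a necessary condition every census row must meet before it can
certify `w` (instrument for pre-registration).

## References
* J. Blasiak, T. Church, H. Cohn, J. A. Grochow, E. Naslund, W. F. Sawin, C. Umans, Discrete Analysis
  2017:3, §2 (packing bounds).
* H. Cohn, R. Kleinberg, B. Szegedy, C. Umans, FOCS 2005, Def. 5.1, Thm. 5.5, §5.
-/

-- single-conjunct summit: the mandated namespace repeats `MatrixMultiplication`.
set_option linter.dupNamespace false

noncomputable section

namespace Summit.MatrixMultiplication.MatrixMultiplication.Theorems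

namespace STPPVolumeThreshold

open Finset Literature.Combinatorics.Additive Literature.Barriers.MatrixMultiplication

variable {G : Type} [Group G] [Fintype G] [DecidableEq G] {ι : Type} [Fintype ι] {A B C : ι → Finset G}

/-- **Packing at exponent `2/3`.**  For an STPP family `(Aᵢ, Bᵢ, Cᵢ)` of non-empty sets in a finite
group `G`, `Σᵢ (|Aᵢ||Bᵢ||Cᵢ|)^{2/3} ≤ |G|`: by AM–GM each term is at most
`(|Aᵢ||Bᵢ| + |Bᵢ||Cᵢ| + |Cᵢ||Aᵢ|)/3`, and each of the three packing sums is `≤ |G|` (Blasiak et al. 2017,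
§2; tree `SimultaneousTPP.sum_card_mul_card_le` applied to the family and its two rotations).
[cite: BlasiakChurchCohnGrochowNaslundSawinUmans2017, §2] -/
theorem sum_rpow_two_thirds_le_card
    (hS : SimultaneousTPP A B C) (hA : ∀ i, (A i).Nonempty) (hB : ∀ i, (B i).Nonempty)
    (hC : ∀ i, (C i).Nonempty) :
    ∑ i, (((A i).card * (B i).card * (C i).card : ℕ) : ℝ) ^ ((2 : ℝ) / 3) ≤ Fintype.card G := by
  have hAB : ((∑ i, (A i).card * (B i).card : ℕ) : ℝ) ≤ Fintype.card G := by
    exact_mod_cast hS.sum_card_mul_card_le hC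
  have hBC : ((∑ i, (B i).card * (C i).card : ℕ) : ℝ) ≤ Fintype.card G := by
    exact_mod_cast (simultaneousTPP_rotate hS).sum_card_mul_card_le hA
  have hCA : ((∑ i, (C i).card * (A i).card : ℕ) : ℝ) ≤ Fintype.card G := by
    exact_mod_cast (simultaneousTPP_rotate (simultaneousTPP_rotate hS)).sum_card_mul_card_le hB
  push_cast at hAB hBC hCA
  calc ∑ i, (((A i).card * (B i).card * (C i).card : ℕ) : ℝ) ^ ((2 : ℝ) / 3)
      ≤ ∑ i, (((A i).card : ℝ) * (B i).card + ((B i).card : ℝ) * (C i).card +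
          ((C i).card : ℝ) * (A i).card) / 3 := by
        refine Finset.sum_le_sum fun i _ => ?_
        push_cast
        exact PairwiseCurvedTilingsLC.Negative.rpow_two_thirds_le (Nat.cast_nonneg _) (Nat.cast_nonneg _)
          (Nat.cast_nonneg _)
    _ = ((∑ i, ((A i).card : ℝ) * (B i).card) + (∑ i, ((B i).card : ℝ) * (C i).card) +
          ∑ i, ((C i).card : ℝ) * (A i).card) / 3 := by
        rw [← Finset.sum_div, Finset.sum_add_distrib, Finset.sum_add_distrib]
    _ ≤ ((Fintype.card G : ℝ) + Fintype.card G + Fintype.card G) / 3 := by gcongr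
    _ = Fintype.card G := by ring

omit [Group G] [DecidableEq G] in
/-- **Volume threshold of a certificate.**  If every triple of the family has volume `Vᵢ ≤ M` and the
certificate inequality `d^{w−2}|G| < Σᵢ Vᵢ^{w/3}` holds for some `w ≥ 2` (the hypothesis of the rows
`STPPCriterion.omega_le_of_stpp_maxCharDegree` / `…_abelianSubgroup`, with `d` the degree bound), then
`d^{w−2}|G| < M^{(w−2)/3} · Σᵢ Vᵢ^{2/3}` — since `Vᵢ^{w/3} = Vᵢ^{(w−2)/3} Vᵢ^{2/3} ≤ M^{(w−2)/3} Vᵢ^{2/3}`.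
[folklore] -/
theorem certificate_volume_threshold {M : ℕ} (hM : ∀ i, (A i).card * (B i).card * (C i).card ≤ M)
    {d w : ℝ} (hw2 : 2 ≤ w)
    (hcert : d ^ (w - 2) * Fintype.card G <
      ∑ i, (((A i).card * (B i).card * (C i).card : ℕ) : ℝ) ^ (w / 3)) :
    d ^ (w - 2) * Fintype.card G <
      (M : ℝ) ^ ((w - 2) / 3) * ∑ i, (((A i).card * (B i).card * (C i).card : ℕ) : ℝ) ^ ((2 : ℝ) / 3) := by
  refine hcert.trans_le ?_
  rw [Finset.mul_sum]
  refine Finset.sum_le_sum fun i _ => ?_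
  set V : ℝ := (((A i).card * (B i).card * (C i).card : ℕ) : ℝ) with hV
  have hV0 : 0 ≤ V := Nat.cast_nonneg _
  have hVM : V ≤ M := by rw [hV]; exact_mod_cast hM i
  have hsplit : V ^ (w / 3) = V ^ ((w - 2) / 3) * V ^ ((2 : ℝ) / 3) := by
    rcases hV0.eq_or_lt with h0 | hpos
    · rw [← h0, Real.zero_rpow (by linarith : w / 3 ≠ 0), Real.zero_rpow (by norm_num : (2 : ℝ) / 3 ≠ 0),
        mul_zero]
    · rw [← Real.rpow_add hpos]; ring_nf
  rw [hsplit]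
  exact mul_le_mul_of_nonneg_right (Real.rpow_le_rpow hV0 hVM (by linarith)) (Real.rpow_nonneg hV0 _)

omit [DecidableEq G] in
/-- **Volume threshold, solved for `M`.**  Under the same hypotheses with `w > 2` and a family of
non-empty sets (so that `S := Σᵢ Vᵢ^{2/3} > 0`; recall `S ≤ |G|`, `sum_rpow_two_thirds_le_card`), and
`d ≥ 0`: `d³ · (|G|/S)^{3/(w−2)} < M`.  With the packing efficiency `η = S/|G| ≤ 1` this reads
`M > d³ η^{−3/(w−2)}` — e.g. `> d³ η^{−8.08}` at `w = 2.3713`. [folklore] -/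
theorem certificate_volume_threshold' [Nonempty ι] {M : ℕ}
    (hM : ∀ i, (A i).card * (B i).card * (C i).card ≤ M) (hA : ∀ i, (A i).Nonempty)
    (hB : ∀ i, (B i).Nonempty) (hC : ∀ i, (C i).Nonempty) {d w : ℝ} (hd : 0 ≤ d) (hw2 : 2 < w)
    (hcert : d ^ (w - 2) * Fintype.card G <
      ∑ i, (((A i).card * (B i).card * (C i).card : ℕ) : ℝ) ^ (w / 3)) :
    d ^ (3 : ℕ) * ((Fintype.card G : ℝ) /
        ∑ i, (((A i).card * (B i).card * (C i).card : ℕ) : ℝ) ^ ((2 : ℝ) / 3)) ^ (3 / (w - 2)) <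
      (M : ℝ) := by
  set S : ℝ := ∑ i, (((A i).card * (B i).card * (C i).card : ℕ) : ℝ) ^ ((2 : ℝ) / 3) with hS
  have hSpos : 0 < S := by
    rw [hS]
    refine Finset.sum_pos (fun i _ => Real.rpow_pos_of_pos ?_ _) Finset.univ_nonempty
    exact_mod_cast Nat.mul_pos (Nat.mul_pos (hA i).card_pos (hB i).card_pos) (hC i).card_pos
  have hGpos : (0 : ℝ) < Fintype.card G := by exact_mod_cast Fintype.card_pos
  have hM0 : (0 : ℝ) ≤ M := Nat.cast_nonneg _
  have h1 := certificate_volume_threshold hM hw2.le hcert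
  -- divide by `S` and take the `(3/(w-2))`-th power
  have h2 : d ^ (w - 2) * (Fintype.card G / S) < (M : ℝ) ^ ((w - 2) / 3) := by
    rw [mul_div_assoc', div_lt_iff₀ hSpos]
    exact h1
  have hexp : 0 < 3 / (w - 2) := by
    apply div_pos (by norm_num); linarith
  have hL0 : 0 ≤ d ^ (w - 2) * (Fintype.card G / S) := by positivity
  have h3 := Real.rpow_lt_rpow hL0 h2 hexp
  have hw0 : w - 2 ≠ 0 := by linarith
  have e1 : (w - 2) * (3 / (w - 2)) = ((3 : ℕ) : ℝ) := by
    rw [mul_div_assoc', mul_comm (w - 2), mul_div_assoc, div_self hw0, mul_one]; norm_num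
  have e2 : (w - 2) / 3 * (3 / (w - 2)) = 1 := by
    rw [div_mul_div_comm, mul_comm (w - 2), div_self (mul_ne_zero (by norm_num) hw0)]
  rw [Real.mul_rpow (Real.rpow_nonneg hd _) (by positivity), ← Real.rpow_mul hd, ← Real.rpow_mul hM0,
    e1, Real.rpow_natCast, e2, Real.rpow_one] at h3
  exact h3

end STPPVolumeThreshold

end Summit.MatrixMultiplication.MatrixMultiplication.Theorems

end
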